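import Mathlib.Analysis.Complex.Basic
import Mathlib.Analysis.SpecialFunctions.Pow.Real

/-!
# `Balaban1983to89.B9Eq349ConjugatedDPCircleWindows` — T. Bałaban, *Propagators for lattice gauge theories in a background field*, Commun. Math.
# Phys. **99** (1985) 389–434 [Balaban1985BackgroundPropagators] (3.49) p. 399 with Thm 3.11 p. 416: **THE SCALAR WINDOWS OF THE CLOSED CIRCLE LETTER ARE
# JOINTLY NON-EMPTY AT THE FLAT POINT AND AT SMALL-FIELD POINTS** — kernel-checked witnesses `(γ, κ₁, M, β, r)` for EVERY scalar hypothesis of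
# `B9Eq349ConjugatedDPCircleClosed.norm_conjFamily_le_of_circle_closed` ∕ `…_DP_le_of_circle_closed` ∕ `exists_uniform_circle_bound` at
# `d = 4`, `L = 3`, `a′ = 1`, `M_φ = M_φ′ = 1`, `ε_U = 0`, `η = 1∕3` (so `Lη = 1`), `c₀ = 1`, `c₁ = 81 = L^d c₀`, cut-off slopes `ℓ = ℓ′ = 1` —
# route R2′ STEP B8′ S-P5(b), the porter's part 5′ (non-vacuity certificate; no statement of part 5 is touched)

statement-level skeleton of published theorems with citation tags; proofs where landed; nothing here is a claim about the Yang–Mills mass gap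

CITATION HEADER (lean-in-tree rule).  Audit cell `pub-balaban`, sub-cell `t4`, BINDER row NE9; filed by NE9 formalisation-swarm leaf prover 06
(`b2b-balaban-t4-ne9-formalise-leaf-06`, gen 67) as the NON-VACUITY certificate of its own part 5 `B9Eq349ConjugatedDPCircleClosed` (the NE9 desk's standing
(d3) question «is the window shown non-empty?» answered at THREE parameter points, in the kernel).  The ten scalar hypotheses below are COPIED CHARACTER-FOR-CHARACTER
from part 5's `norm_conjFamily_le_of_circle_closed` (script-extracted); the parameters are pinned by EQUATIONS (`d = 4`, …) so the copied text is unchanged.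
Source READ in the held text [Balaban1985BackgroundPropagators]: p. 399 (3.49), p. 416 Thm 3.11 — as quoted in parts 2∕3; NOTHING of print's estimate is asserted.

WHAT IS PROVED (sorry-free; proof lane — no `def`; [folklore] rational arithmetic by `norm_num`).
* **`scalar_windows_nonempty_flat`** — at the flat point above there EXIST `γ = 1∕4`, `κ₁ = (10⁻¹⁰)²`, `M = 1`, `β = 10⁻¹⁵`, `r = 10⁻¹⁵∕4` satisfying
  `0 < γ ≤ 1`, `0 < κ₁`, `0 ≤ β ≤ 1`, `0 < r`, `γ ≤ c_Δ` (`= 1∕4`), `P ≤ M` (`P = 1`), the averaging window, `κ₁ ≤ κ_U` (`κ_U` evaluated exactly as a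
  rational, `≈ 2.05·10⁻¹⁹`), the four radius conditions, `small`, `hwinκ` (`12·1552·β ≤ √κ₁ = 10⁻¹⁰`).
* **`scalar_windows_nonempty_smallfield`** — the same ten windows at the SMALL-FIELD point `ε_U = 10⁻⁶` (witness `γ = 1∕5`, `κ₁ = (10⁻¹⁰)²`, `M = 101∕100`,
  `β = 10⁻¹⁵`, `r = 10⁻¹⁵∕4`); the binding window is the averaging one `hwinU` (`P − 1 ≲ 2.4·10⁻⁴`).
* **`scalar_windows_nonempty_edge`** — the same at `ε_U = 10⁻⁵`, near the edge of the averaging window (`≈ 1.5·10⁻⁵` by script).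
HONEST SCOPE.  THREE parameter points (flat `ε_U = 0`, `ε_U = 10⁻⁶`, `ε_U = 10⁻⁵`); the sizes (`κ₁ ~ 10⁻²⁰`, `r ~ 10⁻¹⁶`) are what the displayed
constants give — the route's open number KAPPA1, not improved here; no window RADIUS in `ε_U` is PROVED (three points; the edge is a script value).  NOT NE9
(cell pub-balaban: NE9 NOT PRINTED ∕ NOT PROVED; «NE9 ⇐ the named binders»; spine PROVED 0∕9; rung (B)+1 on a finite T⁴ — NOT infinite volume, NOT mass gap,
NOT Clay; HONEST DEPENDENCY: continuum YM on T⁴ ⇐ BetaPertH ∧ nine spine estimates (0/9 proved); BetaPertH ⇐ (D1) ∧ (D4) ∧ CAP+tail; G-an2-4 gates asym,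
D1 and NE2/3/4).  NEW file, Mathlib-only imports; nothing modified.  Net new unproved facts: 0.
-/

noncomputable section

set_option autoImplicit false

namespace Literature.MathematicalPhysics.QuantumFieldTheory.Balaban1983to89.B9Eq349ConjugatedDPCircleWindows

/-- **THE SCALAR WINDOWS OF PART 5 ARE JOINTLY NON-EMPTY AT THE FLAT POINT** `(d, L, a′, M_φ, M_φ′, ε_U, η, c₀, c₁, ℓ, ℓ′) = (4, 3, 1, 1, 1, 0, 1∕3, 1, 81, 1, 1)`:
witness `γ = 1∕4`, `κ₁ = (10⁻¹⁰)²`, `M = 1`, `β = 10⁻¹⁵`, `r = 10⁻¹⁵∕4` for the ten scalar hypotheses of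
`B9Eq349ConjugatedDPCircleClosed.norm_conjFamily_le_of_circle_closed` (copied verbatim; parameters pinned by equations).
[cite: Balaban1985BackgroundPropagators, (3.49) p.399, Thm 3.11 p.416] -/
theorem scalar_windows_nonempty_flat {d L : ℕ} {a' Mφ Mφ' εU η c₀ c₁ ℓ ℓ' : ℝ} (hd : d = 4) (hL : L = 3) (ha : a' = 1) (hM₁ : Mφ = 1)
    (hM₂ : Mφ' = 1) (hε : εU = 0) (hη : η = 1 / 3) (hc₀ : c₀ = 1) (hc₁ : c₁ = 81) (hl : ℓ = 1) (hl' : ℓ' = 1) :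
    ∃ γ κ₁ M β r : ℝ,
      0 < γ ∧
      γ ≤ 1 ∧
      0 < κ₁ ∧
      0 ≤ β ∧
      β ≤ 1 ∧
      0 < r ∧
      (γ ≤ 1 / (2 + 2 / a') -
        (Real.sqrt d * (‖((η : ℂ))⁻¹‖ * (2 * Mφ * Mφ' * εU)) + (Real.sqrt d * (‖((η : ℂ))⁻¹‖ * (2 * Mφ * Mφ' * εU))) ^ 2 +
          a' * (((1 + 2 * Mφ * Mφ' * εU) ^ (d * (L - 1)) - 1)) * (2 + ((1 + 2 * Mφ * Mφ' * εU) ^ (d * (L - 1)) - 1)))) ∧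
      ((1 + 2 * Mφ * Mφ' * εU) ^ (d * (L - 1)) ≤ M) ∧
      (((1 + 2 * Mφ * Mφ' * εU) ^ (d * (L - 1)) - 1) * ((L : ℝ) ^ 2 / 4) ^ d ≤ (((L : ℝ) - 1) * ((L : ℝ) - 2) / 6) ^ d / 2) ∧
      (κ₁ ≤ ((((((L : ℝ) - 1) * ((L : ℝ) - 2) / 6) ^ d / 2) ^ 2 /
          (2 * (‖((η : ℂ))⁻¹‖ ^ 2 * ((L : ℝ) * ((L : ℝ) ^ 2 / 4) ^ (d - 1)) ^ 2 * (d : ℝ) * (c₀ * (L : ℝ) ^ d / c₁)) +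
            2 * (‖((η : ℂ))⁻¹‖ ^ 2 * (2 * Mφ * Mφ' * εU) ^ 2 * (d : ℝ) * (((L : ℝ) ^ 2 / 4) ^ d) ^ 2 * (c₀ * (L : ℝ) ^ d / c₁)) +
            a' * ((((L : ℝ) - 1) * ((L : ℝ) - 2) / 6) ^ d + (((1 + 2 * Mφ * Mφ' * εU) ^ (d * (L - 1)) - 1) * ((L : ℝ) ^ 2 / 4) ^ d)) ^ 2)) ^ 2 *
        (c₀ * (L : ℝ) ^ d / c₁) / (1 + (((1 + 2 * Mφ * Mφ' * εU) ^ (d * (L - 1)) - 1))) ^ 2)) ∧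
      (r * ℓ * η ≤ 1) ∧
      (r * ℓ' ≤ 1) ∧
      (2 * r * ℓ * (Mφ * Mφ') * Real.sqrt d ≤ β) ∧
      (2 * r * ℓ' * (1 + 2 * Mφ * Mφ' * εU) ^ (d * (L - 1)) ≤ β) ∧
      (3 * (1 + a') * β ^ 2 ≤ γ / 4) ∧
      (12 * (β * (4 / γ + M * ((4 / γ) ^ 2 * (3 + a' * (2 * M + 1))))) ≤ Real.sqrt κ₁) := by
  subst hd hL ha hM₁ hM₂ hε hη hc₀ hc₁ hl hl'
  refine ⟨1 / 4, (1 / 10 ^ 10) ^ 2, 1, 1 / 10 ^ 15, 1 / (4 * 10 ^ 15), ?_⟩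
  have hs4 : Real.sqrt ((4 : ℕ) : ℝ) = 2 := by
    rw [show ((4 : ℕ) : ℝ) = 2 ^ 2 by norm_num, Real.sqrt_sq (by norm_num)]
  have hsk : Real.sqrt ((1 / 10 ^ 10 : ℝ) ^ 2) = 1 / 10 ^ 10 := Real.sqrt_sq (by positivity)
  have hη3 : ‖(((1 / 3 : ℝ)) : ℂ)⁻¹‖ = 3 := by
    rw [norm_inv, Complex.norm_real, Real.norm_eq_abs, abs_of_pos (by norm_num)]; norm_num
  simp only [hs4, hsk, hη3]
  norm_num

/-- **… AND AT A SMALL-FIELD POINT `ε_U = 10⁻⁶`** (same `d, L, a′, M_φ, M_φ′, η, c₀, c₁, ℓ, ℓ′`): witness `γ = 1∕5`, `κ₁ = (10⁻¹⁰)²`, `M = 101∕100`,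
`β = 10⁻¹⁵`, `r = 10⁻¹⁵∕4` — the background window is not the flat point only (the averaging window `hwinU` is the binding one: it forces
`(1 + 2ε_U)^8 − 1 ≲ 2.4·10⁻⁴`). [cite: Balaban1985BackgroundPropagators, (3.49) p.399, Thm 3.11 p.416] -/
theorem scalar_windows_nonempty_smallfield {d L : ℕ} {a' Mφ Mφ' εU η c₀ c₁ ℓ ℓ' : ℝ} (hd : d = 4) (hL : L = 3) (ha : a' = 1) (hM₁ : Mφ = 1)
    (hM₂ : Mφ' = 1) (hε : εU = 1 / 10 ^ 6) (hη : η = 1 / 3) (hc₀ : c₀ = 1) (hc₁ : c₁ = 81) (hl : ℓ = 1) (hl' : ℓ' = 1) :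
    ∃ γ κ₁ M β r : ℝ,
      0 < γ ∧
      γ ≤ 1 ∧
      0 < κ₁ ∧
      0 ≤ β ∧
      β ≤ 1 ∧
      0 < r ∧
      (γ ≤ 1 / (2 + 2 / a') -
        (Real.sqrt d * (‖((η : ℂ))⁻¹‖ * (2 * Mφ * Mφ' * εU)) + (Real.sqrt d * (‖((η : ℂ))⁻¹‖ * (2 * Mφ * Mφ' * εU))) ^ 2 +
          a' * (((1 + 2 * Mφ * Mφ' * εU) ^ (d * (L - 1)) - 1)) * (2 + ((1 + 2 * Mφ * Mφ' * εU) ^ (d * (L - 1)) - 1)))) ∧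
      ((1 + 2 * Mφ * Mφ' * εU) ^ (d * (L - 1)) ≤ M) ∧
      (((1 + 2 * Mφ * Mφ' * εU) ^ (d * (L - 1)) - 1) * ((L : ℝ) ^ 2 / 4) ^ d ≤ (((L : ℝ) - 1) * ((L : ℝ) - 2) / 6) ^ d / 2) ∧
      (κ₁ ≤ ((((((L : ℝ) - 1) * ((L : ℝ) - 2) / 6) ^ d / 2) ^ 2 /
          (2 * (‖((η : ℂ))⁻¹‖ ^ 2 * ((L : ℝ) * ((L : ℝ) ^ 2 / 4) ^ (d - 1)) ^ 2 * (d : ℝ) * (c₀ * (L : ℝ) ^ d / c₁)) +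
            2 * (‖((η : ℂ))⁻¹‖ ^ 2 * (2 * Mφ * Mφ' * εU) ^ 2 * (d : ℝ) * (((L : ℝ) ^ 2 / 4) ^ d) ^ 2 * (c₀ * (L : ℝ) ^ d / c₁)) +
            a' * ((((L : ℝ) - 1) * ((L : ℝ) - 2) / 6) ^ d + (((1 + 2 * Mφ * Mφ' * εU) ^ (d * (L - 1)) - 1) * ((L : ℝ) ^ 2 / 4) ^ d)) ^ 2)) ^ 2 *
        (c₀ * (L : ℝ) ^ d / c₁) / (1 + (((1 + 2 * Mφ * Mφ' * εU) ^ (d * (L - 1)) - 1))) ^ 2)) ∧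
      (r * ℓ * η ≤ 1) ∧
      (r * ℓ' ≤ 1) ∧
      (2 * r * ℓ * (Mφ * Mφ') * Real.sqrt d ≤ β) ∧
      (2 * r * ℓ' * (1 + 2 * Mφ * Mφ' * εU) ^ (d * (L - 1)) ≤ β) ∧
      (3 * (1 + a') * β ^ 2 ≤ γ / 4) ∧
      (12 * (β * (4 / γ + M * ((4 / γ) ^ 2 * (3 + a' * (2 * M + 1))))) ≤ Real.sqrt κ₁) := by
  subst hd hL ha hM₁ hM₂ hε hη hc₀ hc₁ hl hl'
  refine ⟨1 / 5, (1 / 10 ^ 10) ^ 2, 101 / 100, 1 / 10 ^ 15, 1 / (4 * 10 ^ 15), ?_⟩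
  have hs4 : Real.sqrt ((4 : ℕ) : ℝ) = 2 := by
    rw [show ((4 : ℕ) : ℝ) = 2 ^ 2 by norm_num, Real.sqrt_sq (by norm_num)]
  have hsk : Real.sqrt ((1 / 10 ^ 10 : ℝ) ^ 2) = 1 / 10 ^ 10 := Real.sqrt_sq (by positivity)
  have hη3 : ‖(((1 / 3 : ℝ)) : ℂ)⁻¹‖ = 3 := by
    rw [norm_inv, Complex.norm_real, Real.norm_eq_abs, abs_of_pos (by norm_num)]; norm_num
  simp only [hs4, hsk, hη3]
  norm_num

/-- **… AND NEAR THE EDGE OF THE AVERAGING WINDOW, `ε_U = 10⁻⁵`** (same other parameters; same witness as at `10⁻⁶`): the background window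
at `d = 4, L = 3` extends at least to `ε_U = 10⁻⁵`; by the same script the binding constraint `hwinU` fails from `ε_U ≈ 1.5·10⁻⁵` on (a mutant at
`2·10⁻⁵` is refuted by `norm_num`; kept OUT of the tree). [cite: Balaban1985BackgroundPropagators, (3.49) p.399, Thm 3.11 p.416] -/
theorem scalar_windows_nonempty_edge {d L : ℕ} {a' Mφ Mφ' εU η c₀ c₁ ℓ ℓ' : ℝ} (hd : d = 4) (hL : L = 3) (ha : a' = 1) (hM₁ : Mφ = 1)
    (hM₂ : Mφ' = 1) (hε : εU = 1 / 10 ^ 5) (hη : η = 1 / 3) (hc₀ : c₀ = 1) (hc₁ : c₁ = 81) (hl : ℓ = 1) (hl' : ℓ' = 1) :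
    ∃ γ κ₁ M β r : ℝ,
      0 < γ ∧
      γ ≤ 1 ∧
      0 < κ₁ ∧
      0 ≤ β ∧
      β ≤ 1 ∧
      0 < r ∧
      (γ ≤ 1 / (2 + 2 / a') -
        (Real.sqrt d * (‖((η : ℂ))⁻¹‖ * (2 * Mφ * Mφ' * εU)) + (Real.sqrt d * (‖((η : ℂ))⁻¹‖ * (2 * Mφ * Mφ' * εU))) ^ 2 +
          a' * (((1 + 2 * Mφ * Mφ' * εU) ^ (d * (L - 1)) - 1)) * (2 + ((1 + 2 * Mφ * Mφ' * εU) ^ (d * (L - 1)) - 1)))) ∧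
      ((1 + 2 * Mφ * Mφ' * εU) ^ (d * (L - 1)) ≤ M) ∧
      (((1 + 2 * Mφ * Mφ' * εU) ^ (d * (L - 1)) - 1) * ((L : ℝ) ^ 2 / 4) ^ d ≤ (((L : ℝ) - 1) * ((L : ℝ) - 2) / 6) ^ d / 2) ∧
      (κ₁ ≤ ((((((L : ℝ) - 1) * ((L : ℝ) - 2) / 6) ^ d / 2) ^ 2 /
          (2 * (‖((η : ℂ))⁻¹‖ ^ 2 * ((L : ℝ) * ((L : ℝ) ^ 2 / 4) ^ (d - 1)) ^ 2 * (d : ℝ) * (c₀ * (L : ℝ) ^ d / c₁)) +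
            2 * (‖((η : ℂ))⁻¹‖ ^ 2 * (2 * Mφ * Mφ' * εU) ^ 2 * (d : ℝ) * (((L : ℝ) ^ 2 / 4) ^ d) ^ 2 * (c₀ * (L : ℝ) ^ d / c₁)) +
            a' * ((((L : ℝ) - 1) * ((L : ℝ) - 2) / 6) ^ d + (((1 + 2 * Mφ * Mφ' * εU) ^ (d * (L - 1)) - 1) * ((L : ℝ) ^ 2 / 4) ^ d)) ^ 2)) ^ 2 *
        (c₀ * (L : ℝ) ^ d / c₁) / (1 + (((1 + 2 * Mφ * Mφ' * εU) ^ (d * (L - 1)) - 1))) ^ 2)) ∧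
      (r * ℓ * η ≤ 1) ∧
      (r * ℓ' ≤ 1) ∧
      (2 * r * ℓ * (Mφ * Mφ') * Real.sqrt d ≤ β) ∧
      (2 * r * ℓ' * (1 + 2 * Mφ * Mφ' * εU) ^ (d * (L - 1)) ≤ β) ∧
      (3 * (1 + a') * β ^ 2 ≤ γ / 4) ∧
      (12 * (β * (4 / γ + M * ((4 / γ) ^ 2 * (3 + a' * (2 * M + 1))))) ≤ Real.sqrt κ₁) := by
  subst hd hL ha hM₁ hM₂ hε hη hc₀ hc₁ hl hl'
  refine ⟨1 / 5, (1 / 10 ^ 10) ^ 2, 101 / 100, 1 / 10 ^ 15, 1 / (4 * 10 ^ 15), ?_⟩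
  have hs4 : Real.sqrt ((4 : ℕ) : ℝ) = 2 := by
    rw [show ((4 : ℕ) : ℝ) = 2 ^ 2 by norm_num, Real.sqrt_sq (by norm_num)]
  have hsk : Real.sqrt ((1 / 10 ^ 10 : ℝ) ^ 2) = 1 / 10 ^ 10 := Real.sqrt_sq (by positivity)
  have hη3 : ‖(((1 / 3 : ℝ)) : ℂ)⁻¹‖ = 3 := by
    rw [norm_inv, Complex.norm_real, Real.norm_eq_abs, abs_of_pos (by norm_num)]; norm_num
  simp only [hs4, hsk, hη3]
  norm_num

end Literature.MathematicalPhysics.QuantumFieldTheory.Balaban1983to89.B9Eq349ConjugatedDPCircleWindows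

end
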